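import Mathlib
import HarnessLib
import Summits.ValiantsHypothesis.ValiantsHypothesis.Theorems.MonotoneRestorationOrbitRestorationQPSmlAffineFlattening

/-!
# `x_{ab} ↦ y_a` is injective on column-symmetric AFFINE column-set-multilinear expressions
(crux `OrbitRestorationQP`, stmt-ValiantsHypothesis-18293 — lane SML of stub A_∞ `stub_sigmaPiSigmaValue`, extension to
depth-three circuits WITH CONSTANTS; `x`-world half of the normal-form extraction)

`…SmlInjective.lean` proves that the dictionary `f ↦ p = rename Prod.fst f` loses nothing on column-symmetric column-LINEAR
`ΣΠΣ` expressions, by reading the monomial coefficients of `f` off the TOP-order derivatives of `p`.  With AFFINE gates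
`A_{t,b} = β_{t,b} + Σ_a α_{t,b,a} x_{(a,b)}` the expression has monomials of every degree `e ≤ n`, indexed by partial row
assignments `ρ : Fin n → Option (Fin n)` (`ρ b = none` = "take the constant of column `b`"):

* `affineColSml_eq_sum_monomials` — `f = Σ_ρ C (Σ_t Π_b (ρ b).elim β_{t,b} α_{t,b,·}) · Π_{b : ρ b = some a} x_{(a,b)}`;
* `constantCoeff_pderivFold_rename_fst` — for an injective column tuple `κ : Fin e → Fin n` and rows `ρ' : Fin e → Fin n`,
  the CONSTANT TERM of the `e`-th order derivative `∂_{ρ'} p` equals `N_e · Σ_t (Π_i α_{t,κ i,ρ' i}) (Π_{b ∉ im κ} β_{t,b})`,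
  `N_e ≥ 1` the number of injective `Fin e → Fin n` (column symmetry makes all injective column tuples contribute equally;
  `SmlAffineFlattening.pderivFold_prod_affineForms`, `SmlFlattening.rename_fst_pderivFold_of_colSymm`);
* `affineColSml_eq_zero_of_rename_fst_eq_zero` — hence `rename fst f = 0 → f = 0` for column-symmetric affine column-sml
  `f` (every `ρ`-coefficient is such a constant term, after enumerating the columns `b` with `ρ b ≠ none`);
* `affineColSml_eq_of_rename_fst_eq` — and two column-symmetric affine column-sml expressions with the same image are
  equal (difference trick on `ι ⊕ ι'`).

This is what turns the span statement of `…SmlAffineSpan.lean` into an explicit equivariant affine `ΣΠΣ` formula for `f`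
(next file of the lane).  Honest label: helper theorems for a stratum of the off-path sub-rung A_∞; no stub closed; VP ≠ VNP
untouched. [folklore]
-/

set_option linter.dupNamespace false

namespace Summit.ValiantsHypothesis.ValiantsHypothesis.Theorems.SmlAffineInjective

open MvPolynomial SmlDeltaCalculus SmlChainRule SmlFlattening SmlAffineFlattening

/-! ### Monomial expansion -/

/-- An affine column form as a sum over `Option (Fin n)` (`none` = the constant). [folklore] -/
theorem affineForm_eq_sum_option {n : ℕ} (γ : ℂ) (β : Fin n → ℂ) (b : Fin n) :
    (C γ + ∑ a : Fin n, C (β a) * X (a, b) : MvPolynomial (Fin n × Fin n) ℂ) =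
      ∑ o : Option (Fin n), C (o.elim γ β) * o.elim 1 fun a => X (a, b) := by
  rw [Fintype.sum_option]
  simp

/-- **Monomial expansion of an affine column-set-multilinear expression**, indexed by partial row assignments
`ρ : Fin n → Option (Fin n)`. [folklore] -/
theorem affineColSml_eq_sum_monomials {ι : Type*} [Fintype ι] {n : ℕ} (β : ι → Fin n → ℂ) (α : ι → Fin n → Fin n → ℂ) :
    (∑ t : ι, ∏ b : Fin n, (C (β t b) + ∑ a : Fin n, C (α t b a) * X (a, b)) : MvPolynomial (Fin n × Fin n) ℂ) =
      ∑ ρ : Fin n → Option (Fin n), C (∑ t : ι, ∏ b : Fin n, (ρ b).elim (β t b) (α t b)) *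
        ∏ b : Fin n, (ρ b).elim (1 : MvPolynomial (Fin n × Fin n) ℂ) fun a => X (a, b) := by
  classical
  have hterm : ∀ t : ι,
      (∏ b : Fin n, (C (β t b) + ∑ a : Fin n, C (α t b a) * X (a, b)) : MvPolynomial (Fin n × Fin n) ℂ) =
        ∑ ρ : Fin n → Option (Fin n), C (∏ b : Fin n, (ρ b).elim (β t b) (α t b)) *
          ∏ b : Fin n, (ρ b).elim (1 : MvPolynomial (Fin n × Fin n) ℂ) fun a => X (a, b) := by
    intro t
    simp_rw [affineForm_eq_sum_option]
    rw [Fintype.prod_sum (fun b (o : Option (Fin n)) =>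
      C (o.elim (β t b) (α t b)) * o.elim (1 : MvPolynomial (Fin n × Fin n) ℂ) fun a => X (a, b))]
    refine Finset.sum_congr rfl fun ρ _ => ?_
    rw [Finset.prod_mul_distrib, map_prod]
  simp_rw [hterm]
  rw [Finset.sum_comm]
  refine Finset.sum_congr rfl fun ρ _ => ?_
  rw [map_sum, Finset.sum_mul]

/-! ### Constant terms of derivatives of the symmetric shadow -/

/-- The constant term of a product of affine column forms is the product of the constants. [folklore] -/
theorem constantCoeff_prod_affineForms {n : ℕ} (β : Fin n → ℂ) (α : Fin n → Fin n → ℂ) (U : Finset (Fin n)) :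
    constantCoeff (∏ b ∈ U, (C (β b) + ∑ a : Fin n, C (α b a) * X (a, b)) : MvPolynomial (Fin n × Fin n) ℂ) =
      ∏ b ∈ U, β b := by
  rw [map_prod]
  refine Finset.prod_congr rfl fun b _ => ?_
  simp [constantCoeff_X]

/-- **Constant terms of the `e`-th order derivatives of `p = rename fst f` read off the monomial coefficients of `f`.**  For a
column-symmetric affine column-sml `f`, an injective column tuple `κ : Fin e → Fin n` and rows `ρ' : Fin e → Fin n`:
`constantCoeff (∂_{ρ'} p) = N_e · Σ_t (Π_i α_{t,κ i,ρ' i}) (Π_{b ∉ im κ} β_{t,b})`. [folklore] -/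
theorem constantCoeff_pderivFold_rename_fst {ι : Type*} [Fintype ι] {n e : ℕ} (β : ι → Fin n → ℂ)
    (α : ι → Fin n → Fin n → ℂ)
    (hcol : ∀ τ : Equiv.Perm (Fin n), rename (fun v : Fin n × Fin n => (v.1, τ v.2))
      (∑ t : ι, ∏ b : Fin n, (C (β t b) + ∑ a : Fin n, C (α t b a) * X (a, b)) : MvPolynomial (Fin n × Fin n) ℂ) =
      ∑ t : ι, ∏ b : Fin n, (C (β t b) + ∑ a : Fin n, C (α t b a) * X (a, b)))
    (ρ' κ : Fin e → Fin n) (hκ : Function.Injective κ) :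
    constantCoeff (List.foldl (fun (q : MvPolynomial (Fin n) ℂ) i => pderiv (ρ' i) q)
        (rename (Prod.fst : Fin n × Fin n → Fin n)
          (∑ t : ι, ∏ b : Fin n, (C (β t b) + ∑ a : Fin n, C (α t b a) * X (a, b)))) (List.finRange e)) =
      ((Finset.univ.filter fun κ' : Fin e → Fin n => Function.Injective κ').card : ℂ) *
        ∑ t : ι, (∏ i, α t (κ i) (ρ' i)) * ∏ b ∈ Finset.univ \ Finset.univ.image κ, β t b := by
  classical
  rw [pderivFold_rename_fst, map_sum]
  -- each injective `κ'` contributes the same constant, the others contribute `0`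
  have hval : ∀ κ' : Fin e → Fin n, constantCoeff (rename (Prod.fst : Fin n × Fin n → Fin n)
      (List.foldl (fun (q : MvPolynomial (Fin n × Fin n) ℂ) i => pderiv (ρ' i, κ' i) q)
        (∑ t : ι, ∏ b : Fin n, (C (β t b) + ∑ a : Fin n, C (α t b a) * X (a, b))) (List.finRange e))) =
      if Function.Injective κ' then ∑ t : ι, (∏ i, α t (κ i) (ρ' i)) * ∏ b ∈ Finset.univ \ Finset.univ.image κ, β t b
      else 0 := by
    intro κ'
    by_cases hκ' : Function.Injective κ'
    · rw [if_pos hκ', rename_fst_pderivFold_of_colSymm _ hcol ρ' κ κ' hκ hκ', constantCoeff_rename,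
        pderivFoldList_sum, map_sum]
      refine Finset.sum_congr rfl fun t _ => ?_
      have h := pderivFold_prod_affineForms (β t) (α t) e ρ' κ Finset.univ 1
      rw [map_one, one_mul] at h
      rw [h, if_pos ⟨hκ, fun i => Finset.mem_univ _⟩, one_mul, map_mul, constantCoeff_C,
        constantCoeff_prod_affineForms]
    · rw [if_neg hκ', pderivFoldList_sum, map_sum, map_sum]
      refine Finset.sum_eq_zero fun t _ => ?_
      have h := pderivFold_prod_affineForms (β t) (α t) e ρ' κ' Finset.univ 1
      rw [map_one, one_mul] at h
      rw [h, if_neg (fun h' => hκ' h'.1), map_zero, map_zero]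
  simp_rw [hval]
  rw [Finset.sum_ite, Finset.sum_const_zero, add_zero, Finset.sum_const, nsmul_eq_mul]

/-! ### Injectivity -/

/-- **Injectivity.**  A column-symmetric affine column-sml expression with `rename fst f = 0` is `0`. [folklore] -/
theorem affineColSml_eq_zero_of_rename_fst_eq_zero {ι : Type*} [Fintype ι] {n : ℕ} (β : ι → Fin n → ℂ)
    (α : ι → Fin n → Fin n → ℂ)
    (hcol : ∀ τ : Equiv.Perm (Fin n), rename (fun v : Fin n × Fin n => (v.1, τ v.2))
      (∑ t : ι, ∏ b : Fin n, (C (β t b) + ∑ a : Fin n, C (α t b a) * X (a, b)) : MvPolynomial (Fin n × Fin n) ℂ) =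
      ∑ t : ι, ∏ b : Fin n, (C (β t b) + ∑ a : Fin n, C (α t b a) * X (a, b)))
    (h0 : rename (Prod.fst : Fin n × Fin n → Fin n)
      (∑ t : ι, ∏ b : Fin n, (C (β t b) + ∑ a : Fin n, C (α t b a) * X (a, b))) = 0) :
    (∑ t : ι, ∏ b : Fin n, (C (β t b) + ∑ a : Fin n, C (α t b a) * X (a, b)) : MvPolynomial (Fin n × Fin n) ℂ) = 0 := by
  classical
  have hcoef : ∀ ρ : Fin n → Option (Fin n), (∑ t : ι, ∏ b : Fin n, (ρ b).elim (β t b) (α t b)) = 0 := by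
    intro ρ
    -- enumerate the columns carrying a variable
    set S : Finset (Fin n) := Finset.univ.filter fun b => (ρ b).isSome with hS
    set e := S.card with he
    let κ : Fin e → Fin n := fun i => S.orderEmbOfFin rfl i
    have hκ : Function.Injective κ := (S.orderEmbOfFin rfl).injective
    have hκmem : ∀ i, κ i ∈ S := fun i => Finset.orderEmbOfFin_mem S rfl i
    have himage : Finset.univ.image κ = S := by
      apply Finset.coe_injective
      rw [Finset.coe_image, Finset.coe_univ, Set.image_univ]
      exact Finset.range_orderEmbOfFin S rfl
    have hsome : ∀ i, ((ρ (κ i)).isSome : Prop) := fun i => (Finset.mem_filter.1 (hκmem i)).2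
    let ρ' : Fin e → Fin n := fun i => (ρ (κ i)).get (hsome i)
    -- the `ρ`-coefficient is the constant term computed in `constantCoeff_pderivFold_rename_fst`
    have hprod : ∀ t : ι, (∏ b : Fin n, (ρ b).elim (β t b) (α t b)) =
        (∏ i, α t (κ i) (ρ' i)) * ∏ b ∈ Finset.univ \ Finset.univ.image κ, β t b := by
      intro t
      rw [← Finset.prod_filter_mul_prod_filter_not Finset.univ (fun b => ((ρ b).isSome : Prop))]
      congr 1
      · rw [← hS, ← himage, Finset.prod_image (fun i _ i' _ h => hκ h)]
        refine Finset.prod_congr rfl fun i _ => ?_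
        have h : ρ (κ i) = some (ρ' i) := (Option.some_get (hsome i)).symm
        rw [h]
        rfl
      · rw [himage, hS, Finset.filter_not]
        refine Finset.prod_congr rfl fun b hb => ?_
        have hb' : ρ b = none := by
          rw [Finset.mem_sdiff] at hb
          exact Option.not_isSome_iff_eq_none.1 fun h => hb.2 (Finset.mem_filter.2 ⟨Finset.mem_univ _, h⟩)
        rw [hb']
        rfl
    have h := constantCoeff_pderivFold_rename_fst β α hcol ρ' κ hκ
    rw [h0, pderivFoldList_zero, map_zero] at h
    have hN : ((Finset.univ.filter fun κ' : Fin e → Fin n => Function.Injective κ').card : ℂ) ≠ 0 := by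
      rw [Nat.cast_ne_zero]
      exact Finset.card_ne_zero.2 ⟨κ, Finset.mem_filter.2 ⟨Finset.mem_univ _, hκ⟩⟩
    have h' := (mul_eq_zero.1 h.symm).resolve_left hN
    rw [← h']
    exact Finset.sum_congr rfl fun t _ => hprod t
  rw [affineColSml_eq_sum_monomials]
  exact Finset.sum_eq_zero fun ρ _ => by rw [hcoef ρ, map_zero, zero_mul]

/-- **Uniqueness.**  Two column-symmetric affine column-sml expressions (on index types `ι`, `ι'`) with the same
`rename fst`-image are equal. [folklore] -/
theorem affineColSml_eq_of_rename_fst_eq {ι ι' : Type*} [Fintype ι] [Fintype ι'] {n : ℕ}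
    (β : ι → Fin n → ℂ) (α : ι → Fin n → Fin n → ℂ) (β' : ι' → Fin n → ℂ) (α' : ι' → Fin n → Fin n → ℂ)
    (hcol : ∀ τ : Equiv.Perm (Fin n), rename (fun v : Fin n × Fin n => (v.1, τ v.2))
      (∑ t : ι, ∏ b : Fin n, (C (β t b) + ∑ a : Fin n, C (α t b a) * X (a, b)) : MvPolynomial (Fin n × Fin n) ℂ) =
      ∑ t : ι, ∏ b : Fin n, (C (β t b) + ∑ a : Fin n, C (α t b a) * X (a, b)))
    (hcol' : ∀ τ : Equiv.Perm (Fin n), rename (fun v : Fin n × Fin n => (v.1, τ v.2))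
      (∑ t : ι', ∏ b : Fin n, (C (β' t b) + ∑ a : Fin n, C (α' t b a) * X (a, b)) : MvPolynomial (Fin n × Fin n) ℂ) =
      ∑ t : ι', ∏ b : Fin n, (C (β' t b) + ∑ a : Fin n, C (α' t b a) * X (a, b)))
    (heq : rename (Prod.fst : Fin n × Fin n → Fin n)
        (∑ t : ι, ∏ b : Fin n, (C (β t b) + ∑ a : Fin n, C (α t b a) * X (a, b))) =
      rename (Prod.fst : Fin n × Fin n → Fin n)
        (∑ t : ι', ∏ b : Fin n, (C (β' t b) + ∑ a : Fin n, C (α' t b a) * X (a, b)))) :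
    (∑ t : ι, ∏ b : Fin n, (C (β t b) + ∑ a : Fin n, C (α t b a) * X (a, b)) : MvPolynomial (Fin n × Fin n) ℂ) =
      ∑ t : ι', ∏ b : Fin n, (C (β' t b) + ∑ a : Fin n, C (α' t b a) * X (a, b)) := by
  classical
  rcases Nat.eq_zero_or_pos n with rfl | hn
  · -- no columns: both sides are constants, determined by their images
    have h1 : (∑ t : ι, ∏ b : Fin 0, (C (β t b) + ∑ a : Fin 0, C (α t b a) * X (a, b)) :
        MvPolynomial (Fin 0 × Fin 0) ℂ) = C (Fintype.card ι : ℂ) := by simp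
    have h2 : (∑ t : ι', ∏ b : Fin 0, (C (β' t b) + ∑ a : Fin 0, C (α' t b a) * X (a, b)) :
        MvPolynomial (Fin 0 × Fin 0) ℂ) = C (Fintype.card ι' : ℂ) := by simp
    rw [h1, h2] at heq ⊢
    rw [rename_C, rename_C, C_inj] at heq
    rw [heq]
  · obtain ⟨b₀⟩ : Nonempty (Fin n) := ⟨⟨0, hn⟩⟩
    -- the difference is an affine column-sml expression on `ι ⊕ ι'` (negate the factor of column `b₀` of the second part)
    let δ : ι ⊕ ι' → Fin n → ℂ := Sum.elim β (fun t b => (if b = b₀ then -1 else 1) * β' t b)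
    let γ : ι ⊕ ι' → Fin n → Fin n → ℂ := Sum.elim α (fun t b a => (if b = b₀ then -1 else 1) * α' t b a)
    have hγβ : ∀ t : ι', (∏ b : Fin n, (C (δ (Sum.inr t) b) + ∑ a : Fin n, C (γ (Sum.inr t) b a) * X (a, b)) :
        MvPolynomial (Fin n × Fin n) ℂ) = -∏ b : Fin n, (C (β' t b) + ∑ a : Fin n, C (α' t b a) * X (a, b)) := by
      intro t
      have hfac : ∀ b : Fin n, (C (δ (Sum.inr t) b) + ∑ a : Fin n, C (γ (Sum.inr t) b a) * X (a, b) :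
          MvPolynomial (Fin n × Fin n) ℂ) =
          C (if b = b₀ then -1 else 1) * (C (β' t b) + ∑ a : Fin n, C (α' t b a) * X (a, b)) := by
        intro b
        simp only [δ, γ, Sum.elim_inr, map_mul, mul_add, Finset.mul_sum, mul_assoc]
      simp_rw [hfac]
      rw [Finset.prod_mul_distrib, ← map_prod, Finset.prod_ite_eq']
      simp
    have hγ : (∑ t : ι ⊕ ι', ∏ b : Fin n, (C (δ t b) + ∑ a : Fin n, C (γ t b a) * X (a, b)) :
        MvPolynomial (Fin n × Fin n) ℂ) =
        (∑ t : ι, ∏ b : Fin n, (C (β t b) + ∑ a : Fin n, C (α t b a) * X (a, b))) -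
          ∑ t : ι', ∏ b : Fin n, (C (β' t b) + ∑ a : Fin n, C (α' t b a) * X (a, b)) := by
      rw [Fintype.sum_sum_type]
      simp only [δ, γ, Sum.elim_inl]
      rw [sub_eq_add_neg, ← Finset.sum_neg_distrib]
      congr 1
      exact Finset.sum_congr rfl fun t _ => hγβ t
    have hcolγ : ∀ τ : Equiv.Perm (Fin n), rename (fun v : Fin n × Fin n => (v.1, τ v.2))
        (∑ t : ι ⊕ ι', ∏ b : Fin n, (C (δ t b) + ∑ a : Fin n, C (γ t b a) * X (a, b)) :
          MvPolynomial (Fin n × Fin n) ℂ) =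
        ∑ t : ι ⊕ ι', ∏ b : Fin n, (C (δ t b) + ∑ a : Fin n, C (γ t b a) * X (a, b)) := by
      intro τ
      rw [hγ, map_sub, hcol τ, hcol' τ]
    have h0 : rename (Prod.fst : Fin n × Fin n → Fin n)
        (∑ t : ι ⊕ ι', ∏ b : Fin n, (C (δ t b) + ∑ a : Fin n, C (γ t b a) * X (a, b))) = 0 := by
      rw [hγ, map_sub, heq, sub_self]
    have hz := affineColSml_eq_zero_of_rename_fst_eq_zero δ γ hcolγ h0
    rw [hγ, sub_eq_zero] at hz
    exact hz

end Summit.ValiantsHypothesis.ValiantsHypothesis.Theorems.SmlAffineInjective
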